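import Summits.QuantumFields.YangMills.Theorems.SwapVirialDeficitSectorLaplaceBTubeFibred
import Summits.QuantumFields.YangMills.Theorems.SwapVirialDeficitGnomonicTaylorHubLine
import Summits.QuantumFields.YangMills.Theorems.SwapVirialDeficitBlowUpGnomonicStratumBFlat
import Summits.QuantumFields.YangMills.Theorems.SwapVirialDeficitQuantitativeLaplaceCubicDatum
import Summits.QuantumFields.YangMills.Theorems.SwapVirialDeficitQuantitativeLaplaceFibrePackage
import HarnessLib

/-!
# STUB (S-B) OF SKELETON ➎, SOCKETS part 1: JETS, FLAT CRITICAL BASE AND HESSIAN OPERATORS OF THE B-FIBRE `V_B = GnoFibreB L`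
# (free-hands support of ⟨stmt-QuantumFields-24197⟩ `SwapVirialDeficit.SwapGluedStiffness` ∕ ⟨24194⟩; cell ym-idea-1, LEAD memo7 §E(3); the B-twin of
# ✓`…BlowUpGnomonicFibreHessianPackage` §1–§3, feeding the `hA ∕ hAm ∕ hρ ∕ hf` sockets of ✓`bTube_fibred_cylinder`)

The B-tube Laplace variable lives on `X = ℝ × GnoCoord L` (hub letter `δ`, then the gnomonic letters), the deficit there is `F_B(δ, η) := F̂_{hubAt δ 1, ε}(η)`, and the fibre over
the base point `gnoBaseB u` (`u = x_⊥`, stratum B) is the Euclidean space `V_B` of ✓`gnoFibreBEquiv (u, y) = gnoBaseB u + gnoFibreBEmb y`.  This file transports the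
analytic inputs to these letters — nothing is re-derived:
* §1 hub letters: `hubAt_add_one_eq_sub_smul` (`hubAt (δ₀ + t) 1 = hubAt δ₀ 1 − (−t)·1`: every B-ray is one of w3's hub-shift lines), `hubAt_one_im_ne_zero`, `norm_im_hubAt_one`
  (`‖im (hubAt δ 1)‖ = 1`), `hubAt_one_ne_zero`, `hubAt_zero_one_re`; ★ `contDiff_bDeficit` (`(δ, η) ↦ F_B` is `C^n`, w3 ✓`contDiff_gnoDeficit_hubShift`),
  `contDiff_bDeficit_fibreChart` ∕ `contDiff_bDeficit_fibre` (`(p, y) ↦ F_B(p + gnoFibreBEmb y)`);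
* §2 ★ `bFibre_lineJets` — fcl-p3 g47's K7d ✓`taylor_four_gnoDeficit_hubLine` READ ON B-RAYS `s ↦ F_B(p + s·gnoFibreBEmb y)` with letter size `S = ‖y‖_B`
  (`letterSizes_gnoFibreBEmb_le`; hub `a := hubAt p.1 1`, `δ₁ := −y_δ`): `|ψ′| ≤ 1008L⁴‖y‖`, `|ψ″| ≤ 39984L⁴‖y‖²`, `|ψ‴| ≤ 6816096L⁴‖y‖³`, `|ψ⁗| ≤ 1464571584L⁴‖y‖⁴`
  EVERYWHERE plus the two Taylor remainders at `s = 0`; ★ `bFibre_third_bound` ∕ `bFibre_second_bound` (`|D³_y F_B(p + gnoFibreBEmb ·)(z₀)[w,w,w]| ≤ 6816096L⁴‖w‖³`,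
  `|D²…[w,w]| ≤ 39984L⁴‖w‖²` at EVERY fibre point — ✓`third_bound_of_lineJet`);
* §3 the stratum-B base is FLAT AND CRITICAL: `bDeficit_gnoBaseB_eq_zero` (w3 ✓`gnoDeficit_stratumB_eq_zero` at the equatorial hub `hubAt 0 1`), ★ `fderiv_bFibre_base_eq_zero`
  (`F_B ≥ 0 = F_B(base)` ⟹ the base is a minimum ⟹ `D_y F_B(gnoBaseB u + gnoFibreEmb ·)(0) = 0`, ✓`IsLocalMin.fderiv_eq_zero` — no first-order computation);
* §4 ★★★ `exists_bFibreHessian (z χ ε)` — SYMMETRIC operators `A p : V_B →ₗ V_B` indexed by the expansion point `p ∈ X` with the bilinear ∕ form ∕ RAY identities,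
  joint MEASURABILITY of `(p, y) ↦ ⟪A p y, y⟫`, `|⟪A p y, y⟫| ≤ 39984L⁴‖y‖²`, and the order-2 remainder `≤ 3408048L⁴‖y‖³` (✓`exists_hessianOperator`,
  ✓`measurable_inner_of_eq_fibreHessianForm`); ★★ `bFibreHessian_base_cubic` — at the B-base, principal signs: `|F_B(gnoFibreBEquiv (u, y)) − ½⟪A (gnoBaseB u) y, y⟫| ≤ 1136016L⁴‖y‖³`
  for EVERY `y` (✓`cubicDatum_of_third`), and `measurable_bFibreHessianForm_base` (`(u, y) ↦ ⟪A (gnoBaseB u) y, y⟫` measurable) — literally the `hρ ∕ hf ∕ hAm` sockets of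
  ✓`bTube_fibred_cylinder` with `A u := A (gnoBaseB u)`, `ρ′(u,y) := F_B(Ψ_B(u,y)) − ½⟪A u y,y⟫`, `A₃ := 1136016L⁴`.

What is NOT here (part 2): the `√(1+|u|²)`-rescaled `x₀`-letter, the uniform coercivity on `{|u| ≥ τ}` from w3's ✓`fibre_raySecond_ge_stratumB_joint_diag`, the amplitude
`J_B(Ψ_B(u,y)) = w₀(u)(1+e′)`, the far floor, `det A`.  HONEST LABEL: transport of landed results; (S-B), (S-core), (S-001), ⟨24197⟩ ∕ ⟨24194⟩ OPEN; own crux ⟨22884⟩ OPEN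
(blocked-on ⟨19935⟩); the Yang–Mills mass gap is NOT proved; no summit is proved by a line.  THEOREMS ONLY (0 `def`, 0 `sorry`), standard axioms.  Width seat
ym-line-sfw-p2-w2 g59 (cell ym-idea-1, free hands), `--supports stmt-QuantumFields-24197`.  References: [cite: Luscher1983, §2]; [cite: HasenpflugRudolfSprungk2024, §3.1
Assumption 2]; [folklore].
-/

set_option autoImplicit false
set_option synthInstance.maxSize 1024

noncomputable section

open MeasureTheory Quaternion Set Metric
open scoped BigOperators Quaternion ContDiff InnerProductSpace ENNReal
open Literature.MathematicalPhysics.QuantumFieldTheory hiding SU2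
open Literature.MathematicalPhysics.QuantumLattice

namespace Summit.QuantumFields.YangMills.Theorems.SwapVirialDeficit.BlowUpRing

open Summit.QuantumFields.YangMills.Theorems.FemtoTransferGap
open Summit.QuantumFields.YangMills.Theorems.FemtoTransferGap.TT
open Summit.QuantumFields.YangMills.Theorems.VirialFluxGap.RingDeficit
open Summit.QuantumFields.YangMills.Theorems.SwapVirialDeficit.SwapRing
open Summit.QuantumFields.YangMills.Theorems.SwapVirialDeficit.Gnomonic (normSq3 normSq3_nonneg taylor_four_gnoDeficit_hubLine contDiff_gnoDeficit_hubShift)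
open Summit.QuantumFields.YangMills.Theorems.QuantitativeLaplace (exists_hessianOperator iteratedFDeriv_two_eq_lineJet third_bound_of_lineJet cubicDatum_of_third
  measurable_inner_of_eq_fibreHessianForm)

variable {L : ℕ} [NeZero L]

/-! ## §1 Hub letters and smoothness of the B-deficit `F_B(δ, η) = F̂_{hubAt δ 1, ε}(η)` -/

omit [NeZero L] in
/-- `hubAt (δ₀ + t) 1 = hubAt δ₀ 1 − (−t)·1`: moving the hub letter is a REAL SHIFT of the hub (w3's hub-shift family, any centre `δ₀`). [folklore] -/
theorem hubAt_add_one_eq_sub_smul (δ₀ t : ℝ) : hubAt (δ₀ + t) 1 = hubAt δ₀ 1 - (-t) • (1 : ℍ) := by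
  rw [hubAt, hubAt]
  ext <;> simp

omit [NeZero L] in
/-- The hub `hubAt δ 1 = (δ, 1, 0, 0)` has imaginary part `(0, 1, 0, 0) ≠ 0`. [folklore] -/
theorem hubAt_one_im_ne_zero (δ : ℝ) : (hubAt δ 1).im ≠ 0 := by
  intro h
  have h1 := congrArg QuaternionAlgebra.imI h
  simp [hubAt] at h1

omit [NeZero L] in
/-- `‖im (hubAt δ 1)‖ = 1` — so K7d's hub-letter size condition `|δ₁| ≤ S·‖im a‖` reads `|δ₁| ≤ S`. [folklore] -/
theorem norm_im_hubAt_one (δ : ℝ) : ‖(hubAt δ 1).im‖ = 1 := by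
  have h2 : ‖(hubAt δ 1).im‖ ^ 2 = 1 := by
    rw [sq, ← Quaternion.normSq_eq_norm_mul_self, Quaternion.normSq_def']
    simp [hubAt]
  have h0 : 0 ≤ ‖(hubAt δ 1).im‖ := norm_nonneg _
  nlinarith [h2, h0]

omit [NeZero L] in
/-- `hubAt δ 1 ≠ 0`. [folklore] -/
theorem hubAt_one_ne_zero (δ : ℝ) : hubAt δ 1 ≠ 0 := by
  intro h
  have h1 := congrArg QuaternionAlgebra.imI h
  simp [hubAt] at h1

omit [NeZero L] in
/-- The equatorial hub is an END hub: `re (hubAt 0 1) = 0`. [folklore] -/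
theorem hubAt_zero_one_re : (hubAt 0 1).re = 0 := rfl

/-- ★ `(δ, η) ↦ F_B(δ, η) = F̂_{hubAt δ 1, ε}(η)` is `C^n` on `ℝ × GnoCoord L` (w3 ✓`contDiff_gnoDeficit_hubShift` at `hubAt 0 1`, composed with `δ ↦ −δ`). [cite: Luscher1983, §2] -/
theorem contDiff_bDeficit (z : Fin 3 → Bool) (χ : Site 3 L → SU2) (ε : GnoSign L) {n : ℕ∞} :
    ContDiff ℝ n fun p : ℝ × GnoCoord L => gnoDeficit z χ (hubAt p.1 1) ε p.2 := by
  have hc := contDiff_gnoDeficit_hubShift (n := n) z χ hubAt_zero_one_im_ne_zero ε (L := L)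
  have e : (fun p : ℝ × GnoCoord L => gnoDeficit z χ (hubAt p.1 1) ε p.2) =
      (fun p : ℝ × GnoCoord L => gnoDeficit z χ (hubAt 0 1 - p.1 • (1 : ℍ)) ε p.2) ∘ fun p : ℝ × GnoCoord L => (-p.1, p.2) := by
    funext p; simp only [Function.comp_apply, hubAt_eq_equator_sub_smul p.1]
  rw [e]
  exact hc.comp (contDiff_fst.neg.prodMk contDiff_snd)

/-- `(p, y) ↦ F_B(p + gnoFibreBEmb y)` is `C^n` jointly. [cite: Luscher1983, §2] -/
theorem contDiff_bDeficit_fibreChart (z : Fin 3 → Bool) (χ : Site 3 L → SU2) (ε : GnoSign L) {n : ℕ∞} :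
    ContDiff ℝ n fun q : (ℝ × GnoCoord L) × GnoFibreB L =>
      gnoDeficit z χ (hubAt (q.1 + gnoFibreBEmb q.2).1 1) ε (q.1 + gnoFibreBEmb q.2).2 :=
  (contDiff_bDeficit (n := n) z χ ε).comp (contDiff_fst.add ((gnoFibreBEmb (L := L)).contDiff.comp contDiff_snd))

/-- `y ↦ F_B(p + gnoFibreBEmb y)` is `C^n` for every expansion point `p`. [cite: Luscher1983, §2] -/
theorem contDiff_bDeficit_fibre (z : Fin 3 → Bool) (χ : Site 3 L → SU2) (ε : GnoSign L) (p : ℝ × GnoCoord L) {n : ℕ∞} :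
    ContDiff ℝ n fun y : GnoFibreB L => gnoDeficit z χ (hubAt (p + gnoFibreBEmb y).1 1) ε (p + gnoFibreBEmb y).2 :=
  (contDiff_bDeficit (n := n) z χ ε).comp (contDiff_const.add (gnoFibreBEmb (L := L)).contDiff)

/-- Rays of the fibre restriction are B-lines: `F_B(p + gnoFibreBEmb (z₀ + s·y)) = F_B((p + gnoFibreBEmb z₀) + s·gnoFibreBEmb y)`. [folklore] -/
theorem bDeficit_fibre_ray (z : Fin 3 → Bool) (χ : Site 3 L → SU2) (ε : GnoSign L) (p : ℝ × GnoCoord L) (z₀ y : GnoFibreB L) :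
    (fun s : ℝ => gnoDeficit z χ (hubAt (p + gnoFibreBEmb (z₀ + s • y)).1 1) ε (p + gnoFibreBEmb (z₀ + s • y)).2) =
      fun s : ℝ => gnoDeficit z χ (hubAt ((p + gnoFibreBEmb z₀) + s • gnoFibreBEmb y).1 1) ε ((p + gnoFibreBEmb z₀) + s • gnoFibreBEmb y).2 := by
  funext s; rw [map_add, map_smul, add_assoc]

/-- A B-line IS one of K7d's joint hub–letter lines: `F_B(p + s·gnoFibreBEmb y) = F̂_{hubAt p.1 1 − (s·(−y_δ))·1, ε}(p.2 + s·(gnoFibreBEmb y).2)`. [folklore] -/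
theorem bDeficit_ray_eq_hubLine (z : Fin 3 → Bool) (χ : Site 3 L → SU2) (ε : GnoSign L) (p : ℝ × GnoCoord L) (y : GnoFibreB L) :
    (fun s : ℝ => gnoDeficit z χ (hubAt (p + s • gnoFibreBEmb y).1 1) ε (p + s • gnoFibreBEmb y).2) =
      fun s : ℝ => gnoDeficit z χ (hubAt p.1 1 - (s * -(gnoFibreBEmb y).1) • (1 : ℍ)) ε (p.2 + s • (gnoFibreBEmb y).2) := by
  funext s
  rw [Prod.fst_add, Prod.snd_add, Prod.smul_fst, Prod.smul_snd, smul_eq_mul, hubAt_add_one_eq_sub_smul, mul_neg]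

/-- The end point of a B-line in K7d's letters: `F_B(p + gnoFibreBEmb y) = F̂_{hubAt p.1 1 − (−y_δ)·1, ε}(p.2 + (gnoFibreBEmb y).2)`. [folklore] -/
theorem bDeficit_add_eq_hubShift (z : Fin 3 → Bool) (χ : Site 3 L → SU2) (ε : GnoSign L) (p : ℝ × GnoCoord L) (y : GnoFibreB L) :
    gnoDeficit z χ (hubAt (p + gnoFibreBEmb y).1 1) ε (p + gnoFibreBEmb y).2 =
      gnoDeficit z χ (hubAt p.1 1 - (-(gnoFibreBEmb y).1) • (1 : ℍ)) ε (p.2 + (gnoFibreBEmb y).2) := by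
  rw [Prod.fst_add, Prod.snd_add, hubAt_add_one_eq_sub_smul]

/-! ## §2 Line jets along B-rays (K7d read with `S = ‖y‖_B`) -/

/-- Every letter of `gnoFibreBEmb y` has Euclidean size-square `≤ ‖y‖²`: `y_δ²`, `Σ_k x_k²` (`= x₀²`), `Σ_k y_k²`, `Σ_k z_k²`, `Σ_k η_{f,k}²`. [folklore] -/
theorem letterSq_gnoFibreBEmb_le (y : GnoFibreB L) :
    (gnoFibreBEmb y).1 ^ 2 ≤ ‖y‖ ^ 2 ∧ (∑ k, (gnoFibreBEmb y).2.1.1 k ^ 2 ≤ ‖y‖ ^ 2) ∧ (∑ k, (gnoFibreBEmb y).2.1.2 k ^ 2 ≤ ‖y‖ ^ 2) ∧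
      (∑ k, (gnoFibreBEmb y).2.2.1 k ^ 2 ≤ ‖y‖ ^ 2) ∧ ∀ i, ∑ k, (gnoFibreBEmb y).2.2.2 i k ^ 2 ≤ ‖y‖ ^ 2 := by
  have hN := norm_sq_gnoFibreB y
  have h0 : 0 ≤ (gnoFibreBBlocks y).1.1 0 ^ 2 := sq_nonneg _
  have h0' : 0 ≤ (gnoFibreBBlocks y).1.1 1 ^ 2 := sq_nonneg _
  have h0'' : 0 ≤ (gnoFibreBBlocks y).1.1 2 ^ 2 := sq_nonneg _
  have h1 : 0 ≤ (gnoFibreBBlocks y).1.2 0 ^ 2 + (gnoFibreBBlocks y).1.2 1 ^ 2 := by positivity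
  have h2 : 0 ≤ normSq3 (gnoFibreBBlocks y).2.1 := Finset.sum_nonneg fun k _ => sq_nonneg _
  have h3 : 0 ≤ ∑ f, normSq3 ((gnoFibreBBlocks y).2.2 f) := Finset.sum_nonneg fun f _ => Finset.sum_nonneg fun k _ => sq_nonneg _
  have et : normSq3 (gnoFibreBBlocks y).1.1 = (gnoFibreBBlocks y).1.1 0 ^ 2 + (gnoFibreBBlocks y).1.1 1 ^ 2 + (gnoFibreBBlocks y).1.1 2 ^ 2 := by
    simp only [normSq3, Fin.sum_univ_three]
  have eδ : (gnoFibreBEmb y).1 ^ 2 = (gnoFibreBBlocks y).1.1 0 ^ 2 := rfl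
  have ex : ∑ k, (gnoFibreBEmb y).2.1.1 k ^ 2 = (gnoFibreBBlocks y).1.1 1 ^ 2 := by
    simp only [gnoFibreBEmb_apply, gnoFibreBBlocks, Fin.sum_univ_three, Matrix.cons_val_zero, Matrix.cons_val_one, Matrix.cons_val_two,
      Matrix.tail_cons, Matrix.head_cons]; ring
  have ey : ∑ k, (gnoFibreBEmb y).2.1.2 k ^ 2 = (gnoFibreBBlocks y).1.1 2 ^ 2 + ((gnoFibreBBlocks y).1.2 0 ^ 2 + (gnoFibreBBlocks y).1.2 1 ^ 2) := by
    simp only [gnoFibreBEmb_apply, gnoFibreBBlocks, Fin.sum_univ_three, Matrix.cons_val_zero, Matrix.cons_val_one, Matrix.cons_val_two,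
      Matrix.tail_cons, Matrix.head_cons]; ring
  have ez : ∑ k, (gnoFibreBEmb y).2.2.1 k ^ 2 = normSq3 (gnoFibreBBlocks y).2.1 := rfl
  have ef : ∀ i, ∑ k, (gnoFibreBEmb y).2.2.2 i k ^ 2 = normSq3 ((gnoFibreBBlocks y).2.2 i) := fun i => rfl
  refine ⟨?_, ?_, ?_, ?_, fun i => ?_⟩
  · rw [eδ, hN, et]; nlinarith
  · rw [ex, hN, et]; nlinarith
  · rw [ey, hN, et]; nlinarith
  · rw [ez, hN, et]; nlinarith
  · rw [ef, hN, et]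
    have hi : normSq3 ((gnoFibreBBlocks y).2.2 i) ≤ ∑ f, normSq3 ((gnoFibreBBlocks y).2.2 f) :=
      Finset.single_le_sum (f := fun f => normSq3 ((gnoFibreBBlocks y).2.2 f)) (fun f _ => Finset.sum_nonneg fun k _ => sq_nonneg _) (Finset.mem_univ i)
    nlinarith

/-- Every letter of `gnoFibreBEmb y` has Euclidean size `≤ ‖y‖` — the `S` (and `|δ₁| ≤ S·‖im a‖` with `‖im a‖ = 1`) of K7d ✓`taylor_four_gnoDeficit_hubLine`. [folklore] -/
theorem letterSizes_gnoFibreBEmb_le (y : GnoFibreB L) :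
    |(gnoFibreBEmb y).1| ≤ ‖y‖ ∧ Real.sqrt (∑ k, (gnoFibreBEmb y).2.1.1 k ^ 2) ≤ ‖y‖ ∧ Real.sqrt (∑ k, (gnoFibreBEmb y).2.1.2 k ^ 2) ≤ ‖y‖ ∧
      Real.sqrt (∑ k, (gnoFibreBEmb y).2.2.1 k ^ 2) ≤ ‖y‖ ∧ ∀ i, Real.sqrt (∑ k, (gnoFibreBEmb y).2.2.2 i k ^ 2) ≤ ‖y‖ := by
  obtain ⟨hδ, hx, hy, hz, hf⟩ := letterSq_gnoFibreBEmb_le y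
  have hn : 0 ≤ ‖y‖ := norm_nonneg _
  exact ⟨abs_le_of_sq_le_sq' hδ hn |> fun h => abs_le.2 h, (Real.sqrt_le_sqrt hx).trans_eq (Real.sqrt_sq hn), (Real.sqrt_le_sqrt hy).trans_eq (Real.sqrt_sq hn),
    (Real.sqrt_le_sqrt hz).trans_eq (Real.sqrt_sq hn), fun i => (Real.sqrt_le_sqrt (hf i)).trans_eq (Real.sqrt_sq hn)⟩

/-- ★ **K7d's LINE JETS along a B-ray, letter size `S = ‖y‖_B`**: with `ψ s = F_B(p + s·gnoFibreBEmb y)`: `|ψ′| ≤ 1008L⁴‖y‖`, `|ψ″| ≤ 39984L⁴‖y‖²`, `|ψ‴| ≤ 6816096L⁴‖y‖³`,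
`|ψ⁗| ≤ 1464571584L⁴‖y‖⁴` everywhere, and the order-2 ∕ order-3 Taylor remainders at `s = 0`. [cite: Luscher1983, §2] -/
theorem bFibre_lineJets (z : Fin 3 → Bool) (χ : Site 3 L → SU2) (ε : GnoSign L) (p : ℝ × GnoCoord L) (y : GnoFibreB L) :
    (∀ s, |deriv (fun s : ℝ => gnoDeficit z χ (hubAt (p + s • gnoFibreBEmb y).1 1) ε (p + s • gnoFibreBEmb y).2) s| ≤ 1008 * (L : ℝ) ^ 4 * ‖y‖ ∧
        |iteratedDeriv 2 (fun s : ℝ => gnoDeficit z χ (hubAt (p + s • gnoFibreBEmb y).1 1) ε (p + s • gnoFibreBEmb y).2) s| ≤ 39984 * (L : ℝ) ^ 4 * ‖y‖ ^ 2 ∧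
        |iteratedDeriv 3 (fun s : ℝ => gnoDeficit z χ (hubAt (p + s • gnoFibreBEmb y).1 1) ε (p + s • gnoFibreBEmb y).2) s| ≤ 6816096 * (L : ℝ) ^ 4 * ‖y‖ ^ 3 ∧
        |iteratedDeriv 4 (fun s : ℝ => gnoDeficit z χ (hubAt (p + s • gnoFibreBEmb y).1 1) ε (p + s • gnoFibreBEmb y).2) s| ≤
          1464571584 * (L : ℝ) ^ 4 * ‖y‖ ^ 4) ∧
      |gnoDeficit z χ (hubAt (p + gnoFibreBEmb y).1 1) ε (p + gnoFibreBEmb y).2 - gnoDeficit z χ (hubAt p.1 1) ε p.2 -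
            deriv (fun s : ℝ => gnoDeficit z χ (hubAt (p + s • gnoFibreBEmb y).1 1) ε (p + s • gnoFibreBEmb y).2) 0 -
            iteratedDeriv 2 (fun s : ℝ => gnoDeficit z χ (hubAt (p + s • gnoFibreBEmb y).1 1) ε (p + s • gnoFibreBEmb y).2) 0 / 2| ≤
          6816096 * (L : ℝ) ^ 4 * ‖y‖ ^ 3 / 2 ∧
      |gnoDeficit z χ (hubAt (p + gnoFibreBEmb y).1 1) ε (p + gnoFibreBEmb y).2 - gnoDeficit z χ (hubAt p.1 1) ε p.2 -
            deriv (fun s : ℝ => gnoDeficit z χ (hubAt (p + s • gnoFibreBEmb y).1 1) ε (p + s • gnoFibreBEmb y).2) 0 -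
            iteratedDeriv 2 (fun s : ℝ => gnoDeficit z χ (hubAt (p + s • gnoFibreBEmb y).1 1) ε (p + s • gnoFibreBEmb y).2) 0 / 2 -
            iteratedDeriv 3 (fun s : ℝ => gnoDeficit z χ (hubAt (p + s • gnoFibreBEmb y).1 1) ε (p + s • gnoFibreBEmb y).2) 0 / 6| ≤
          1464571584 * (L : ℝ) ^ 4 * ‖y‖ ^ 4 / 6 := by
  obtain ⟨hδ, hx, hy, hz, hf⟩ := letterSizes_gnoFibreBEmb_le (L := L) y
  have hδ' : |(-(gnoFibreBEmb y).1)| ≤ ‖y‖ * ‖(hubAt p.1 1).im‖ := by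
    rw [abs_neg, norm_im_hubAt_one, mul_one]; exact hδ
  have h := taylor_four_gnoDeficit_hubLine z χ (hubAt_one_im_ne_zero p.1) (-(gnoFibreBEmb y).1) ε p.2 (gnoFibreBEmb y).2 (norm_nonneg y) hδ' hx hy hz hf
  rw [bDeficit_ray_eq_hubLine, bDeficit_add_eq_hubShift]
  exact h

/-- ★ **THE DIRECTIONAL THIRD DERIVATIVE ON THE WHOLE B-FIBRE**: `|D³_y (F_B(p + gnoFibreBEmb ·))(z₀)[w,w,w]| ≤ 6816096L⁴‖w‖³` at EVERY fibre point `z₀`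
(✓`third_bound_of_lineJet`; the `h3` of ✓`cubicDatum_of_third`, the `A₃` of ✓`hessian_lower_on_closedBall_of_cubes`). [cite: Luscher1983, §2] -/
theorem bFibre_third_bound (z : Fin 3 → Bool) (χ : Site 3 L → SU2) (ε : GnoSign L) (p : ℝ × GnoCoord L) (z₀ w : GnoFibreB L) :
    |iteratedFDeriv ℝ 3 (fun y : GnoFibreB L => gnoDeficit z χ (hubAt (p + gnoFibreBEmb y).1 1) ε (p + gnoFibreBEmb y).2) z₀ (fun _ => w)| ≤
      6816096 * (L : ℝ) ^ 4 * ‖w‖ ^ 3 := by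
  refine third_bound_of_lineJet (S := univ) (contDiff_bDeficit_fibre (n := 3) z χ ε p) (fun z₁ _ ξ => ?_) z₀ (mem_univ _) w
  rw [bDeficit_fibre_ray]
  exact ((bFibre_lineJets z χ ε (p + gnoFibreBEmb z₁) ξ).1 0).2.2.1

/-- ★ **THE DIRECTIONAL SECOND DERIVATIVE ON THE WHOLE B-FIBRE**: `|D²_y (F_B(p + gnoFibreBEmb ·))(z₀)[w,w]| ≤ 39984L⁴‖w‖²`. [cite: Luscher1983, §2] -/
theorem bFibre_second_bound (z : Fin 3 → Bool) (χ : Site 3 L → SU2) (ε : GnoSign L) (p : ℝ × GnoCoord L) (z₀ w : GnoFibreB L) :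
    |iteratedFDeriv ℝ 2 (fun y : GnoFibreB L => gnoDeficit z χ (hubAt (p + gnoFibreBEmb y).1 1) ε (p + gnoFibreBEmb y).2) z₀ (fun _ => w)| ≤
      39984 * (L : ℝ) ^ 4 * ‖w‖ ^ 2 := by
  rw [iteratedFDeriv_two_eq_lineJet (contDiff_bDeficit_fibre (n := 2) z χ ε p) z₀ w, bDeficit_fibre_ray]
  exact ((bFibre_lineJets z χ ε (p + gnoFibreBEmb z₀) w).1 0).2.1

/-! ## §3 The stratum-B base is flat and critical -/

/-- ★ **THE B-BASE IS FLAT** (principal signs `ε_z = +`, followers `+`): `F_B(gnoBaseB u) = 0` — w3 ✓`gnoDeficit_stratumB_eq_zero` at the END hub `hubAt 0 1`. [cite: Luscher1983, §2] -/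
theorem bDeficit_gnoBaseB_eq_zero (ε : GnoSign L) (hz : ε.2.1 = true) (hF : ε.2.2 = fun _ => true) (u : ℝ × ℝ) :
    gnoDeficit (fun _ => false) (fun _ => 1) (hubAt (gnoBaseB (L := L) u).1 1) ε (gnoBaseB (L := L) u).2 = 0 :=
  gnoDeficit_stratumB_eq_zero (hubAt_one_ne_zero 0) hubAt_zero_one_re ε hz hF u.1 u.2

/-- The fibre restriction vanishes at the origin of the fibre over a B-base point. [folklore] -/
theorem bFibre_base_apply_zero (ε : GnoSign L) (hz : ε.2.1 = true) (hF : ε.2.2 = fun _ => true) (u : ℝ × ℝ) :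
    (fun y : GnoFibreB L => gnoDeficit (fun _ => false) (fun _ => 1) (hubAt (gnoBaseB u + gnoFibreBEmb y).1 1) ε (gnoBaseB u + gnoFibreBEmb y).2) 0 = 0 := by
  simp only [map_zero, add_zero]
  exact bDeficit_gnoBaseB_eq_zero ε hz hF u

/-- ★ **THE B-BASE IS CRITICAL**: `D_y (F_B(gnoBaseB u + gnoFibreBEmb ·))(0) = 0` — the deficit is `≥ 0` (✓`gnoDeficit_nonneg`) and `= 0` at the base, so the origin of
the fibre is a minimum (✓`IsLocalMin.fderiv_eq_zero`). [folklore] -/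
theorem fderiv_bFibre_base_eq_zero (ε : GnoSign L) (hz : ε.2.1 = true) (hF : ε.2.2 = fun _ => true) (u : ℝ × ℝ) :
    fderiv ℝ (fun y : GnoFibreB L => gnoDeficit (fun _ => false) (fun _ => 1) (hubAt (gnoBaseB u + gnoFibreBEmb y).1 1) ε (gnoBaseB u + gnoFibreBEmb y).2) 0 = 0 := by
  refine IsLocalMin.fderiv_eq_zero (Filter.Eventually.of_forall fun y => ?_)
  rw [bFibre_base_apply_zero ε hz hF u]
  exact gnoDeficit_nonneg _ _ _ _ _

/-! ## §4 The Hessian operator family of the B-fibre -/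

/-- ★★★ **THE HESSIAN OPERATORS OF THE B-FIBRE.**  For every sector `z`, character `χ` and signs `ε` there is a family `A : (ℝ × GnoCoord L) → V_B →ₗ[ℝ] V_B`
(indexed by the expansion point `p`) of SYMMETRIC operators with: the bilinear identity `⟪A p y, w⟫ = D(D(F_B(p + gnoFibreBEmb ·)))(0)[y][w]`, the form identity, the RAY
identity `⟪A p y, y⟫ = (d²/ds²) F_B(p + s·gnoFibreBEmb y)|₀` (so w3's B-ray floors read on `A`), the joint MEASURABILITY of `(p, y) ↦ ⟪A p y, y⟫`, the bound
`|⟪A p y, y⟫| ≤ 39984L⁴‖y‖²`, and the order-2 Taylor remainder `|F_B(p + gnoFibreBEmb y) − F_B p − ψ′(0) − ½⟪A p y, y⟫| ≤ 3408048L⁴‖y‖³` at EVERY `p`.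
[cite: Luscher1983, §2] [cite: HasenpflugRudolfSprungk2024, §3.1 Assumption 2] -/
theorem exists_bFibreHessian (z : Fin 3 → Bool) (χ : Site 3 L → SU2) (ε : GnoSign L) :
    ∃ A : (ℝ × GnoCoord L) → GnoFibreB L →ₗ[ℝ] GnoFibreB L,
      (∀ p, (A p).IsSymmetric) ∧
      (∀ p (y w : GnoFibreB L), ⟪A p y, w⟫_ℝ =
        fderiv ℝ (fderiv ℝ (fun y' : GnoFibreB L => gnoDeficit z χ (hubAt (p + gnoFibreBEmb y').1 1) ε (p + gnoFibreBEmb y').2)) 0 y w) ∧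
      (∀ p (y : GnoFibreB L), ⟪A p y, y⟫_ℝ =
        iteratedFDeriv ℝ 2 (fun y' : GnoFibreB L => gnoDeficit z χ (hubAt (p + gnoFibreBEmb y').1 1) ε (p + gnoFibreBEmb y').2) 0 (fun _ => y)) ∧
      (∀ p (y : GnoFibreB L), ⟪A p y, y⟫_ℝ =
        iteratedDeriv 2 (fun s : ℝ => gnoDeficit z χ (hubAt (p + s • gnoFibreBEmb y).1 1) ε (p + s • gnoFibreBEmb y).2) 0) ∧
      (Measurable fun q : (ℝ × GnoCoord L) × GnoFibreB L => ⟪A q.1 q.2, q.2⟫_ℝ) ∧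
      (∀ p (y : GnoFibreB L), |⟪A p y, y⟫_ℝ| ≤ 39984 * (L : ℝ) ^ 4 * ‖y‖ ^ 2) ∧
      (∀ p (y : GnoFibreB L), |gnoDeficit z χ (hubAt (p + gnoFibreBEmb y).1 1) ε (p + gnoFibreBEmb y).2 - gnoDeficit z χ (hubAt p.1 1) ε p.2 -
            deriv (fun s : ℝ => gnoDeficit z χ (hubAt (p + s • gnoFibreBEmb y).1 1) ε (p + s • gnoFibreBEmb y).2) 0 - (1 / 2) * ⟪A p y, y⟫_ℝ| ≤
          3408048 * (L : ℝ) ^ 4 * ‖y‖ ^ 3) := by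
  have h2 : (2 : WithTop ℕ∞) ≤ 2 := le_rfl
  have hex := fun p : ℝ × GnoCoord L => exists_hessianOperator ((contDiff_bDeficit_fibre (n := 2) z χ ε p).contDiffAt (x := (0 : GnoFibreB L))) h2
  choose A hAs hAyw hAyy using hex
  -- the ray identity
  have hray : ∀ p (y : GnoFibreB L), ⟪A p y, y⟫_ℝ =
      iteratedDeriv 2 (fun s : ℝ => gnoDeficit z χ (hubAt (p + s • gnoFibreBEmb y).1 1) ε (p + s • gnoFibreBEmb y).2) 0 := fun p y => by
    rw [hAyy, iteratedFDeriv_two_eq_lineJet (contDiff_bDeficit_fibre (n := 2) z χ ε p) 0 y, bDeficit_fibre_ray, map_zero, add_zero]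
  refine ⟨A, hAs, hAyw, hAyy, hray, ?_, fun p y => ?_, fun p y => ?_⟩
  · -- measurability: the Hessian form of the jointly smooth `G (p, y) = F_B(p + gnoFibreBEmb y)` along `ι = id`, `y⋆ = 0`
    have h2' : (2 : WithTop ℕ∞) ≤ ((2 : ℕ∞) : WithTop ℕ∞) := le_rfl
    exact measurable_inner_of_eq_fibreHessianForm
      (G := fun q : (ℝ × GnoCoord L) × GnoFibreB L => gnoDeficit z χ (hubAt (q.1 + gnoFibreBEmb q.2).1 1) ε (q.1 + gnoFibreBEmb q.2).2)
      (contDiff_bDeficit_fibreChart (n := 2) z χ ε) h2' (M := ℝ × GnoCoord L) (ι := id) continuous_id (ys := fun _ => (0 : GnoFibreB L)) continuous_const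
      (A := fun p y => A p y) (B := fun _ y => y) (fun p y => hAyy p y)
  · rw [hray]; exact ((bFibre_lineJets z χ ε p y).1 0).2.1
  · have h := (bFibre_lineJets z χ ε p y).2.1
    rw [hray]
    have e : (1 / 2 : ℝ) * iteratedDeriv 2 (fun s : ℝ => gnoDeficit z χ (hubAt (p + s • gnoFibreBEmb y).1 1) ε (p + s • gnoFibreBEmb y).2) 0 =
        iteratedDeriv 2 (fun s : ℝ => gnoDeficit z χ (hubAt (p + s • gnoFibreBEmb y).1 1) ε (p + s • gnoFibreBEmb y).2) 0 / 2 := by ring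
    rw [e]
    refine h.trans (le_of_eq ?_)
    ring

/-- ★★ **THE CUBIC DATUM AT THE B-BASE** (principal signs): `|F_B(gnoFibreBEquiv (u, y)) − ½⟪A (gnoBaseB u) y, y⟫| ≤ 1136016L⁴‖y‖³` for EVERY `y` (no radius) —
✓`cubicDatum_of_third` with `hg0` ∕ `hg1` = `bFibre_base_apply_zero` ∕ `fderiv_bFibre_base_eq_zero` and `h3` = `bFibre_third_bound`; the `hρ ∕ hf` sockets of
✓`bTube_fibred_cylinder` with `ρ′(u, y) := F_B(Ψ_B(u,y)) − ½⟪A u y, y⟫`, `A₃ := 1136016L⁴`. [cite: Luscher1983, §2] -/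
theorem bFibreHessian_base_cubic (ε : GnoSign L) (hz : ε.2.1 = true) (hF : ε.2.2 = fun _ => true)
    {A : (ℝ × GnoCoord L) → GnoFibreB L →ₗ[ℝ] GnoFibreB L}
    (hAyy : ∀ p (y : GnoFibreB L), ⟪A p y, y⟫_ℝ =
      iteratedFDeriv ℝ 2 (fun y' : GnoFibreB L => gnoDeficit (fun _ => false) (fun _ => 1) (hubAt (p + gnoFibreBEmb y').1 1) ε (p + gnoFibreBEmb y').2) 0 (fun _ => y))
    (u : ℝ × ℝ) (y : GnoFibreB L) :
    |gnoDeficit (fun _ => false) (fun _ => 1) (hubAt (gnoFibreBEquiv (u, y)).1 1) ε (gnoFibreBEquiv (u, y)).2 - (1 / 2) * ⟪A (gnoBaseB u) y, y⟫_ℝ| ≤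
      1136016 * (L : ℝ) ^ 4 * ‖y‖ ^ 3 := by
  have h := cubicDatum_of_third (R := ‖y‖) (A₃ := 6816096 * (L : ℝ) ^ 4) (contDiff_bDeficit_fibre (n := 3) _ _ ε (gnoBaseB u))
    (bFibre_base_apply_zero ε hz hF u) (fderiv_bFibre_base_eq_zero ε hz hF u) (fun z₀ _ w => bFibre_third_bound _ _ ε (gnoBaseB u) z₀ w) y le_rfl
  rw [← hAyy] at h
  rw [gnoFibreBEquiv_apply]
  refine h.trans (le_of_eq ?_)
  ring

/-- `(u, y) ↦ ⟪A (gnoBaseB u) y, y⟫` is measurable (the `hAm` socket of ✓`bTube_fibred_cylinder` for `A u := A (gnoBaseB u)`). [folklore] -/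
theorem measurable_bFibreHessianForm_base {A : (ℝ × GnoCoord L) → GnoFibreB L →ₗ[ℝ] GnoFibreB L}
    (hAm : Measurable fun q : (ℝ × GnoCoord L) × GnoFibreB L => ⟪A q.1 q.2, q.2⟫_ℝ) :
    Measurable fun q : (ℝ × ℝ) × GnoFibreB L => ⟪A (gnoBaseB q.1) q.2, q.2⟫_ℝ := by
  have h : Measurable fun q : (ℝ × ℝ) × GnoFibreB L => ((gnoBaseB q.1 : ℝ × GnoCoord L), q.2) :=
    (continuous_gnoBaseB.measurable.comp measurable_fst).prodMk measurable_snd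
  have e : (fun q : (ℝ × ℝ) × GnoFibreB L => ⟪A (gnoBaseB q.1) q.2, q.2⟫_ℝ) =
      (fun q : (ℝ × GnoCoord L) × GnoFibreB L => ⟪A q.1 q.2, q.2⟫_ℝ) ∘ fun q : (ℝ × ℝ) × GnoFibreB L => ((gnoBaseB q.1 : ℝ × GnoCoord L), q.2) := rfl
  rw [e]
  have h2 := Measurable.comp hAm h
  exact h2

/-- ★★ **THE B-SOCKETS, part 1 (one existential)**: principal signs; operators `A u` on `V_B` indexed by the base `u ∈ ℝ²`, symmetric, `(u,y) ↦ ⟪A u y,y⟫` measurable, the RAY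
identity at the B-base (the letter in which w3's ✓`fibre_raySecond_ge_stratumB_joint_diag` is stated, up to the name of the hub shift), `|⟪A u y,y⟫| ≤ 39984L⁴‖y‖²`, and the cubic
datum `F_B(Ψ_B(u,y)) − 0 = ½⟪A u y,y⟫ + ρ′(u,y)`, `ρ′` measurable, `|ρ′(u,y)| ≤ 1136016L⁴‖y‖³` for ALL `(u, y)`. [cite: Luscher1983, §2] [cite: HasenpflugRudolfSprungk2024, §3.1 Assumption 2] -/
theorem bFibre_sockets_cubic (ε : GnoSign L) (hz : ε.2.1 = true) (hF : ε.2.2 = fun _ => true) :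
    ∃ (A : ℝ × ℝ → GnoFibreB L →ₗ[ℝ] GnoFibreB L) (ρ' : (ℝ × ℝ) × GnoFibreB L → ℝ),
      (∀ u, (A u).IsSymmetric) ∧
      (Measurable fun q : (ℝ × ℝ) × GnoFibreB L => ⟪A q.1 q.2, q.2⟫_ℝ) ∧
      (∀ u (y : GnoFibreB L), ⟪A u y, y⟫_ℝ =
        iteratedDeriv 2 (fun s : ℝ => gnoDeficit (fun _ => false) (fun _ => 1) (hubAt (gnoBaseB u + s • gnoFibreBEmb y).1 1) ε (gnoBaseB u + s • gnoFibreBEmb y).2) 0) ∧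
      (∀ u (y : GnoFibreB L), |⟪A u y, y⟫_ℝ| ≤ 39984 * (L : ℝ) ^ 4 * ‖y‖ ^ 2) ∧
      Measurable ρ' ∧
      (∀ u (y : GnoFibreB L), |ρ' (u, y)| ≤ 1136016 * (L : ℝ) ^ 4 * ‖y‖ ^ 3) ∧
      (∀ u (y : GnoFibreB L),
        gnoDeficit (fun _ => false) (fun _ => 1) (hubAt (gnoFibreBEquiv (u, y)).1 1) ε (gnoFibreBEquiv (u, y)).2 - 0 = (1 / 2) * ⟪A u y, y⟫_ℝ + ρ' (u, y)) := by
  obtain ⟨A, hAs, -, hAyy, hray, hAm, hAbd, -⟩ := exists_bFibreHessian (fun _ => false) (fun _ => 1) ε (L := L)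
  refine ⟨fun u => A (gnoBaseB u),
    fun q => gnoDeficit (fun _ => false) (fun _ => 1) (hubAt (gnoFibreBEquiv q).1 1) ε (gnoFibreBEquiv q).2 - (1 / 2) * ⟪A (gnoBaseB q.1) q.2, q.2⟫_ℝ,
    fun u => hAs _, measurable_bFibreHessianForm_base hAm, fun u y => hray _ y, fun u y => hAbd _ y, ?_, fun u y => bFibreHessian_base_cubic ε hz hF hAyy u y,
    fun u y => by ring⟩
  exact ((measurable_bDeficit _ _ ε).comp measurable_gnoFibreBEquiv).sub (measurable_const.mul (measurable_bFibreHessianForm_base hAm))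

end Summit.QuantumFields.YangMills.Theorems.SwapVirialDeficit.BlowUpRing

end
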